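import Literature.Geometry.Riemannian.ShrinkerEntropyProofs
import Literature.Geometry.Riemannian.ShrinkerPotentialGrowth

/-!
# Stub `stub_modelValueSplitLine` (U2) of line `collapsed-ends-usc`, crux
# `EntropyRung.NoncompactShrinkerGap` (stmt-SmoothPoincare4-10868) — part 3: the shrinker factor `N`

Helper file (`--supports`) for the registered stub `stub_modelValueSplitLine`: the facts about a
complete connected normalised gradient shrinker `(N, h, φ)` (`Ric_h + Hess φ = h/2`,
`R_h + |∇φ|² = φ`) that the `N`-factor `F_K(φ(y))` of the test function `W_K` on `N × ℝ` consumes,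
all PROVED from the growth fact `shrinkerPotentialGrowth` (Haslhofer–Müller 2011, §2: `R ≥ 0`,
`¼(d − 5n)₊² ≤ φ`) and the proved layer `ShrinkerEntropyProofs.lean` of Carrillo–Ni 2009:
* `isCompact_sublevel_of_growth` — the potential is proper: `{φ ≤ R} ⊆ B̄(p, 5n + 2√R₊ + 1)`;
* `integral_potential_mul_exp_neg` — `∫_N φ e^{-φ} dV = (n/2) ∫_N e^{-φ} dV` (Carrillo–Ni §4:
  `∫ Δ(e^{-φ}) dV = 0` on the complete soliton, `Δ(e^{-φ}) = (φ − n/2) e^{-φ}`), the sharpness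
  identity behind the exact model value `log((4π)^{-n/2} ∫ e^{-φ})`;
* `shrinkerWeights` — `R ≥ 0`, `φ ≥ 0`, properness, and integrability of the four weights `e^{-φ}`,
  `R e^{-φ}`, `|∇φ|² e^{-φ}`, `φ e^{-φ}` from the two facts' hypotheses;
* `gradSq_comp_mul_const`, `hasCompactSupport_comp` — the chain rule
  `|∇(F(φ) c)|² = c² F'(φ)² |∇φ|²`, and compact support of `F ∘ φ` for `F` vanishing on `[2K, ∞)`;
* `sigmaFinite_riemVolume`, `integral_exp_neg_pos` — `dV_h` is σ-finite (Fubini on `N × ℝ`) and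
  `∫ e^{-φ} dV_h > 0`.
No new definitions; everything is proved.

## References

* [HaslhoferMuller2011] R. Haslhofer, R. Müller, *A compactness theorem for complete Ricci
  shrinkers*, GAFA 21 (2011) 1091–1116, §2: (2.6), Lemma 2.1 (growth of the potential).
* [CarrilloNi2009] J. A. Carrillo, L. Ni, *Sharp logarithmic Sobolev inequalities on gradient
  solitons and applications*, Comm. Anal. Geom. 17 (2009) 721–753, §4 and Cor. 2.1.
-/

noncomputable section

-- `Summit.SmoothPoincare4.SmoothPoincare4.…` (summit = problem) trips `dupNamespace` on every decl.
set_option linter.dupNamespace false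

namespace Summit.SmoothPoincare4.SmoothPoincare4.Theorems.NoncompactShrinkerGapModelValueSplitLine

open scoped Manifold ContDiff Topology ENNReal NNReal
open MeasureTheory Filter Set
open Literature.Geometry.Lorentzian Literature.Geometry.Riemannian

section Shrinker

variable {n : ℕ} {N : Type} [TopologicalSpace N] [ChartedSpace (EuclideanSpace ℝ (Fin n)) N]
  [IsManifold (𝓡 n) ∞ N]
  {h : PseudoRiemannianMetric (𝓡 n) ∞ (EuclideanSpace ℝ (Fin n)) (TangentSpace (𝓡 n) : N → Type _)}
  {φ : N → ℝ}

/-! ### Properness of the potential from the growth bound -/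

/-- **The potential of a complete shrinker is proper**: if closed `edist`-balls are compact and
`¼(r − 5n)₊² ≤ φ(x)` whenever `r ≤ d(p, x)` (Haslhofer–Müller 2011, Lemma 2.1), then every
sublevel set `{φ ≤ R}` is compact — it is closed and contained in the closed ball of radius
`5n + 2√(R₊) + 1` about `p`. [cite: HaslhoferMuller2011, §2, Lemma 2.1] -/
theorem isCompact_sublevel_of_growth (hh : h.IsRiemannian)
    (hc : ∀ (y : N) (r : NNReal), IsCompact {z : N | h.edist hh y z ≤ r}) (hφc : Continuous φ)
    {p : N} (hlow : ∀ (x : N) (r : NNReal), (r : ℝ≥0∞) ≤ h.edist hh p x →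
      (1 / 4 : ℝ) * (max ((r : ℝ) - 5 * n) 0) ^ 2 ≤ φ x) (R : ℝ) :
    IsCompact {y : N | φ y ≤ R} := by
  have hv : 0 ≤ 5 * (n : ℝ) + 2 * Real.sqrt (max R 0) + 1 := by positivity
  set r₀ : NNReal := (5 * (n : ℝ) + 2 * Real.sqrt (max R 0) + 1).toNNReal with hr₀
  refine (hc p r₀).of_isClosed_subset (isClosed_le hφc continuous_const) fun x hx ↦ ?_
  rw [mem_setOf_eq] at hx ⊢
  by_contra hlt
  have hle : (r₀ : ℝ≥0∞) ≤ h.edist hh p x := le_of_lt (not_le.1 hlt)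
  have h1 := hlow x r₀ hle
  have hr : (r₀ : ℝ) - 5 * n = 2 * Real.sqrt (max R 0) + 1 := by
    rw [hr₀, Real.coe_toNNReal _ hv]; ring
  rw [hr, max_eq_left (by positivity)] at h1
  have hs : Real.sqrt (max R 0) ^ 2 = max R 0 := Real.sq_sqrt (le_max_right R 0)
  have hR : R ≤ max R 0 := le_max_left _ _
  nlinarith [Real.sqrt_nonneg (max R 0)]

/-! ### Chain rule for `|∇·|²` and compact support of the cut factor -/

/-- **Chain rule** `|∇(F(φ) · c)|²_h (y) = c² · (F'(φ y)² |∇φ|²_h (y))` for `F ∈ C^∞(ℝ)` with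
`F'(φ y)` its derivative at `φ y`. [folklore] -/
theorem gradSq_comp_mul_const (hφ : ContMDiff (𝓡 n) 𝓘(ℝ, ℝ) ∞ φ) {F : ℝ → ℝ} (hF : ContDiff ℝ ∞ F)
    {F' : ℝ} {y : N} (hF' : HasDerivAt F F' (φ y)) (c : ℝ) :
    h.gradSq (fun z ↦ F (φ z) * c) y = c ^ 2 * (F' ^ 2 * h.gradSq φ y) := by
  have hφy : MDifferentiableAt (𝓡 n) 𝓘(ℝ, ℝ) φ y := hφ.mdifferentiableAt (by simp)
  have hFφ : MDifferentiableAt (𝓡 n) 𝓘(ℝ, ℝ) (F ∘ φ) y :=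
    (hF.comp_contMDiff hφ).mdifferentiableAt (by simp)
  have h1 := h.gradSq_real_comp (h := fun s : ℝ ↦ s * c) (hasDerivAt_mul_const c) hFφ
  have h2 := h.gradSq_real_comp hF' hφy
  rw [show (fun z ↦ F (φ z) * c) = (fun s : ℝ ↦ s * c) ∘ (F ∘ φ) from rfl, h1, h2]

/-- **Compact support of the cut factor**: if `F = 0` on `[2K, ∞)` and the sublevel sets of the
continuous `φ` are compact, then `F ∘ φ` has compact support, contained in `{φ ≤ 2K}`. [folklore] -/
theorem hasCompactSupport_comp (hφc : Continuous φ) (hprop : ∀ R : ℝ, IsCompact {y : N | φ y ≤ R})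
    {F : ℝ → ℝ} {K : ℝ} (hF0 : ∀ s, 2 * K ≤ s → F s = 0) :
    HasCompactSupport (fun z ↦ F (φ z)) ∧ tsupport (fun z ↦ F (φ z)) ⊆ {y : N | φ y ≤ 2 * K} := by
  have hcl : IsClosed {y : N | φ y ≤ 2 * K} := isClosed_le hφc continuous_const
  have hzero : ∀ z ∉ {y : N | φ y ≤ 2 * K}, F (φ z) = 0 := fun z hz ↦
    hF0 _ (le_of_lt (not_le.1 hz))
  refine ⟨HasCompactSupport.intro' (hprop _) hcl hzero, closure_minimal (fun z hz ↦ ?_) hcl⟩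
  by_contra hz'
  exact hz (hzero z hz')

/-! ### The weights of a complete normalised shrinker -/

variable [T2Space N] [T3Space N] [MeasurableSpace N] [BorelSpace N] [h.HasLeviCivita]

/-- **`∫_N φ e^{-φ} dV = (n/2) ∫_N e^{-φ} dV`** on a gradient shrinker with proper potential and
`R ≥ 0` (Carrillo–Ni 2009, §4: `∫ Δ(e^{-φ}) dV = 0` by the cut-off Green identity
`integral_dalembertian_eq_zero_of_proper`, and `Δ(e^{-φ}) = (φ − n/2) e^{-φ}`,
`dalembertian_exp_neg`) — the identity that makes `(4π)^{-n/2} e^{-φ}/Θ` the exact minimiser.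
[cite: CarrilloNi2009, §4 with Lemma 2.1 and Cor. 2.1] -/
theorem integral_potential_mul_exp_neg (hh : h.IsRiemannian) (hφ : ContMDiff (𝓡 n) 𝓘(ℝ, ℝ) ∞ φ)
    (hsol : ∀ (x : N) (X Y : TangentSpace (𝓡 n) x),
      h.ricci x X Y + h.hessian φ x X Y = (1 / 2 : ℝ) * h.val x X Y)
    (hnorm : ∀ x : N, h.scalarCurvature x + h.gradSq φ x = φ x)
    (hprop : ∀ R : ℝ, IsCompact {y : N | φ y ≤ R}) (hR0 : ∀ x : N, 0 ≤ h.scalarCurvature x) :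
    ∫ y, φ y * Real.exp (-φ y) ∂h.riemVolume = n / 2 * ∫ y, Real.exp (-φ y) ∂h.riemVolume := by
  obtain ⟨hint, hfint⟩ :=
    CarrilloNi2009_shrinkerLSI.integrable_exp_neg_of_proper hh hφ hsol hnorm hprop
  have hgint := (CarrilloNi2009_shrinkerLSI.integrable_gradSq_mul_exp_neg_of_proper hh hφ hsol
    hnorm hprop (B := 0) (fun x ↦ by simpa using hR0 x)).2
  have h2 : ContMDiff (𝓡 n) 𝓘(ℝ, ℝ) 2 (fun y ↦ Real.exp (-φ y)) :=
    ((Real.contDiff_exp.comp contDiff_neg).comp_contMDiff hφ).of_le ENat.LEInfty.out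
  have hpt : ∀ x, h.dalembertian (fun y ↦ Real.exp (-φ y)) x = (φ x - n / 2) * Real.exp (-φ x) :=
    CarrilloNi2009_shrinkerLSI.dalembertian_exp_neg hsol hnorm hφ
  have hΔ : Integrable (fun x ↦ h.dalembertian (fun y ↦ Real.exp (-φ y)) x) h.riemVolume := by
    refine (hfint.sub (hint.const_mul ((n : ℝ) / 2))).congr (Eventually.of_forall fun x ↦ ?_)
    simp only [Pi.sub_apply, hpt]
    ring
  have hcross : Integrable (fun x ↦ h.innerDual x (mvfderiv (𝓡 n) φ x).toLinearMap
      (mvfderiv (𝓡 n) (fun y ↦ Real.exp (-φ y)) x).toLinearMap) h.riemVolume := by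
    refine hgint.neg.congr (Eventually.of_forall fun x ↦ ?_)
    show -(h.gradSq φ x * Real.exp (-φ x)) = h.innerDual x (mvfderiv (𝓡 n) φ x).toLinearMap
      (mvfderiv (𝓡 n) (fun y ↦ Real.exp (-φ y)) x).toLinearMap
    rw [CarrilloNi2009_shrinkerLSI.innerDual_mvfderiv_exp_neg (hφ.mdifferentiableAt (by norm_num)),
      PseudoRiemannianMetric.gradSq]
    ring
  have h0 := CarrilloNi2009_shrinkerLSI.integral_dalembertian_eq_zero_of_proper hh hφ hprop h2 hΔ
    hcross
  simp_rw [hpt] at h0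
  have hsplit : ∀ x, (φ x - n / 2) * Real.exp (-φ x) =
      φ x * Real.exp (-φ x) - (n : ℝ) / 2 * Real.exp (-φ x) := fun x ↦ by ring
  simp_rw [hsplit] at h0
  rw [integral_sub hfint (hint.const_mul _), integral_const_mul] at h0
  linarith

/-- **The weights of a complete connected normalised shrinker** (consequences of the growth fact
`shrinkerPotentialGrowth`, Haslhofer–Müller 2011 §2, and Carrillo–Ni 2009 Cor. 2.1 as proved in
`ShrinkerEntropyProofs.lean`): `R ≥ 0`, `0 ≤ |∇φ|² ≤ φ`, `R ≤ φ`, the potential is proper, and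
`e^{-φ}`, `φ e^{-φ}`, `R e^{-φ}`, `|∇φ|² e^{-φ}` are integrable for `dV_h`.
[cite: HaslhoferMuller2011, §2: (2.6), Lemma 2.1] -/
theorem shrinkerWeights [SecondCountableTopology N] [ConnectedSpace N]
    (hgrowth : shrinkerPotentialGrowth) (hh : h.IsRiemannian)
    (hc : ∀ (y : N) (r : NNReal), IsCompact {z : N | h.edist hh y z ≤ r})
    (hφ : ContMDiff (𝓡 n) 𝓘(ℝ, ℝ) ∞ φ)
    (hsol : ∀ (x : N) (X Y : TangentSpace (𝓡 n) x),
      h.ricci x X Y + h.hessian φ x X Y = (1 / 2 : ℝ) * h.val x X Y)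
    (hnorm : ∀ x : N, h.scalarCurvature x + h.gradSq φ x = φ x) :
    (∀ x : N, 0 ≤ h.scalarCurvature x) ∧ (∀ x : N, 0 ≤ h.gradSq φ x) ∧
    (∀ x : N, h.scalarCurvature x ≤ φ x) ∧ (∀ x : N, h.gradSq φ x ≤ φ x) ∧ (∀ x : N, 0 ≤ φ x) ∧
    (∀ R : ℝ, IsCompact {y : N | φ y ≤ R}) ∧
    Integrable (fun y ↦ Real.exp (-φ y)) h.riemVolume ∧
    Integrable (fun y ↦ φ y * Real.exp (-φ y)) h.riemVolume ∧
    Integrable (fun y ↦ h.scalarCurvature y * Real.exp (-φ y)) h.riemVolume ∧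
    Integrable (fun y ↦ h.gradSq φ y * Real.exp (-φ y)) h.riemVolume := by
  obtain ⟨C₂, hC₂⟩ := hgrowth n
  obtain ⟨hR0, p, -, hlow, -, -⟩ := hC₂ N h φ hh hc hφ hsol hnorm
  have hG0 : ∀ x : N, 0 ≤ h.gradSq φ x := fun x ↦ h.gradSq_nonneg hh φ x
  have hRle : ∀ x : N, h.scalarCurvature x ≤ φ x := fun x ↦ by linarith [hnorm x, hG0 x]
  have hGle : ∀ x : N, h.gradSq φ x ≤ φ x := fun x ↦ by linarith [hnorm x, hR0 x]
  have hφ0 : ∀ x : N, 0 ≤ φ x := fun x ↦ (hR0 x).trans (hRle x)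
  have hprop : ∀ R : ℝ, IsCompact {y : N | φ y ≤ R} :=
    isCompact_sublevel_of_growth hh hc hφ.continuous hlow
  obtain ⟨hint, hfint⟩ :=
    CarrilloNi2009_shrinkerLSI.integrable_exp_neg_of_proper hh hφ hsol hnorm hprop
  obtain ⟨hRint, hgint⟩ := CarrilloNi2009_shrinkerLSI.integrable_gradSq_mul_exp_neg_of_proper hh hφ
    hsol hnorm hprop (B := 0) (fun x ↦ by simpa using hR0 x)
  exact ⟨hR0, hG0, hRle, hGle, hφ0, hprop, hint, hfint, hRint, hgint⟩

omit [T2Space N] [h.HasLeviCivita] in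
/-- The Riemannian measure of a manifold exhausted by a proper continuous function is s-finite
(σ-compact and finite on compacts), so that Fubini applies on `N × ℝ`. [folklore] -/
theorem sigmaFinite_riemVolume (hh : h.IsRiemannian)
    (hprop : ∀ R : ℝ, IsCompact {y : N | φ y ≤ R}) : SigmaFinite h.riemVolume := by
  haveI : SigmaCompactSpace N := ⟨⟨fun k : ℕ ↦ {x | φ x ≤ k}, fun k ↦ hprop k,
    eq_univ_of_forall fun x ↦ mem_iUnion.2 (exists_nat_ge (φ x))⟩⟩
  haveI := CarrilloNi2009_shrinkerLSI.isFiniteMeasureOnCompacts_riemVolume (g := h) hh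
  infer_instance

omit [T2Space N] [h.HasLeviCivita] in
/-- **`∫_N e^{-φ} dV > 0`** on a nonempty Riemannian manifold with integrable `e^{-φ}`.
[folklore] -/
theorem integral_exp_neg_pos [Nonempty N] (hh : h.IsRiemannian)
    (hint : Integrable (fun y ↦ Real.exp (-φ y)) h.riemVolume) :
    0 < ∫ y, Real.exp (-φ y) ∂h.riemVolume := by
  rw [integral_pos_iff_support_of_nonneg (fun x ↦ (Real.exp_pos _).le) hint]
  have : Function.support (fun y ↦ Real.exp (-φ y)) = univ := by
    ext x; simp [Real.exp_ne_zero]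
  simpa [this] using PseudoRiemannianMetric.riemVolume_univ_pos hh

end Shrinker

/-- **Registered sub-goal `stub_shrinkerPotentialMoment` of the crux** (the deciding statement of
this file): on a gradient shrinker `Ric + Hess φ = h/2`, `R + |∇φ|² = φ` with proper potential and
`R ≥ 0`, `∫_N φ e^{-φ} dV_h = (n/2) ∫_N e^{-φ} dV_h` — Carrillo–Ni's sharpness identity
(`integral_potential_mul_exp_neg`, fully quantified).
[cite: CarrilloNi2009, §4 with Lemma 2.1 and Cor. 2.1] -/
theorem stub_shrinkerPotentialMoment : ∀ (n : ℕ) (N : Type) [TopologicalSpace N] [ChartedSpace (EuclideanSpace ℝ (Fin n)) N] [IsManifold (𝓡 n) ∞ N] [T2Space N] [T3Space N] [MeasurableSpace N] [BorelSpace N] (h : Literature.Geometry.Lorentzian.PseudoRiemannianMetric (𝓡 n) ∞ (EuclideanSpace ℝ (Fin n)) (TangentSpace (𝓡 n) : N → Type _)) [h.HasLeviCivita] (φ : N → ℝ), h.IsRiemannian → ContMDiff (𝓡 n) 𝓘(ℝ, ℝ) ∞ φ → (∀ (x : N) (X Y : TangentSpace (𝓡 n) x), h.ricci x X Y + h.hessian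 φ x X Y = (1 / 2 : ℝ) * h.val x X Y) → (∀ x : N, h.scalarCurvature x + h.gradSq φ x = φ x) → (∀ R : ℝ, IsCompact {y : N | φ y ≤ R}) → (∀ x : N, 0 ≤ h.scalarCurvature x) → ∫ y, φ y * Real.exp (-φ y) ∂h.riemVolume = n / 2 * ∫ y, Real.exp (-φ y) ∂h.riemVolume :=
  fun _ _ _ _ _ _ _ _ _ _ _ _ hh hφ hsol hnorm hprop hR0 ↦
    integral_potential_mul_exp_neg hh hφ hsol hnorm hprop hR0

end Summit.SmoothPoincare4.SmoothPoincare4.Theorems.NoncompactShrinkerGapModelValueSplitLine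

end
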